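import Literature.RepresentationTheory.HarrisKudlaSweet1996.GlobalSplittingCharactersQuadExt
import Literature.NumberTheory.Automorphic.QuadraticHeckeCharacterRealPlaces
import Literature.NumberTheory.Automorphic.QuadraticArchimedeanBaseChange
import HarnessLib

/-!
# Archimedean components of a global splitting character `χ|_{𝕀_F} = ε_{E/F}` of an ARBITRARY quadratic `E/F`:
# the product formula at `∞`, its regrouping over the places of `F`, and triviality over the places split in `E`

Topic `NumberTheory/GelbartRogawski1991`; namespace `Literature.NumberTheory.GelbartRogawski1991.UnitaryDualPair.ArchSplitting`
(sub-namespace `QuadExt`).  The archimedean twin of `QuadExtSplittingCharLocalComponents` (finite places) and the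
general-`E/F` companion of `CMSplittingCharArchComponents` (CM fields, where `χ_w = (z/|z|)^{e_w}` comes from the CM arch-type
classification).  KERNEL only: proved theorems; no definition, no named fact, no `sorry`.

Vocabulary (all tree): the idèle `⟨y⟩_w = infiniteIdeleSingle w y` supported at the infinite place `w`; the archimedean
component `χ_w = χ.archComponent w : E_wˣ →* ℂˣ` of a Hecke character (`BookerKrishnamurthyConverse`); the local base change
`ι_w = toInfPlace E v w : F_v →+* E_w` at `w ∣ v` and the base change of idèles `𝕀_F → 𝕀_E` (`AdeleRing.ideleBaseChange`);
`ε_{E/F} = quadraticHeckeCharExt F E`; the splitting condition `IsSplittingCharExt F E m χ` (`χ(x_E) = ε_{E/F}(x)^m`,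
[HarrisKudlaSweet1996, §1 (1.5)]; [GelbartRogawski1991, §3.1 (3.1.2)]).

* §1 (any number field `K`) `eq_prod_infiniteIdeleSingle_of_snd_eq_one` (`u = ∏_w ⟨u_w⟩_w` for an idèle `u` with trivial
  finite part) and the PRODUCT FORMULA **`apply_eq_prod_archComponent_of_snd_eq_one`**: `χ(u) = ∏_{w ∣ ∞} χ_w(u_w)`;
  `prod_infinitePlace_eq_prod_placesOver`: `∏_{w ∣ ∞ of E} f w = ∏_{v ∣ ∞ of F} ∏_{w ∣ v} f w` (regrouping along
  `w ↦ w|_F`, Mathlib `Equiv.sigmaFiberEquiv`).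
* §2 (`E/F` finite) **`ideleBaseChange_infiniteIdeleSingle`**: `(⟨x⟩_v)_E = ∏_{w ∣ v} ⟨ι_w x⟩_w`, hence
  `apply_ideleBaseChange_infiniteIdeleSingle`: `χ((⟨x⟩_v)_E) = ∏_{w ∣ v} χ_w(ι_w x)`.
* §3 (`E/F` quadratic, `χ|_{𝕀_F} = ε^m`) **`IsSplittingCharExt.prod_archComponent_placesOver`**:
  `∏_{w ∣ v} χ_w(ι_w x) = ε_v(x)^m` for every infinite place `v` of `F` and `x ∈ F_vˣ`; at a COMPLEX place `v`
  (always split in `E`: two places `w ≠ c w` above it, `ε_v = 1`) **`…_of_isComplex`**: `∏_{w ∣ v} χ_w(ι_w x) = 1` — the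
  two components over `v` are mutually inverse along the local base changes (the archimedean twin of
  `QuadExt.localComponent_galInv_inv_eq`); at a REAL place `v` split in `E` (`ε_v = 1`, `quadraticHeckeChar_…_of_pos`) the same
  with the positivity hypothesis on the generator; at a real place INERT in `E` the product is `ε_v(x)^m = sgn(x)^m`
  (`quadraticHeckeChar_…_of_neg`).

Use: the character side of the archimedean twist at the complex places of `F` (type (iii)) of the general-`E/F` kernel
construction of [GelbartRogawski1991, Prop. 3.1.1] (E totally complex, `F` arbitrary; GR lane, seat GR-1 for GR-2's W3 assembly):
with `σ_w ∘ ι_w = ψ_w ∘ σ_v` (`ψ_w ∈ {id, conj}`, `Weil1964/ArchActQuadraticComplexPlaces`) §3 says that, read in `ℂˣ`, the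
component at `c w` is the inverse of the `ψ`-twisted component at `w`, so that on the Siegel parabolic
`χ_w(det α_w) χ_{cw}(det α_{cw})` is a character of `det g₊` alone.  Nothing here is a claim of the manuscripts adjudicated
by the Hodge-CM cell.

## References

* [HarrisKudlaSweet1996] M. Harris, S. Kudla, W. Sweet, JAMS 9 (1996), §1 (1.5) p. 951.
* [GelbartRogawski1991] S. Gelbart, J. Rogawski, Invent. Math. 105 (1991), §3.1 p. 456 (3.1.2).
* [TateThesis1967] J. Tate, *Fourier analysis in number fields and Hecke's zeta-functions*, §4.3.
* [CasselsFrohlichANT1967] J. W. S. Cassels, A. Fröhlich (eds.), *Algebraic Number Theory* (1967), Ch. II §14.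
-/

set_option autoImplicit false

noncomputable section

open scoped NumberField Classical
open NumberField NumberField.InfinitePlace IsDedekindDomain

open _root_.Literature.NumberTheory.Automorphic _root_.Literature.NumberTheory.Automorphic.UnitaryGroup
open _root_.Literature.NumberTheory.GaloisRepresentations
open _root_.Literature.RepresentationTheory.HarrisKudlaSweet1996

namespace Literature.NumberTheory.GelbartRogawski1991.UnitaryDualPair.ArchSplitting.QuadExt

/-! ## §1 The product formula `χ((y,1)) = ∏_w χ_w(y_w)` and regrouping over the places of the base -/

section AnyField

variable (K : Type) [Field K] [NumberField K]

/-- the `w''`-component of a product of idèles is the product of the `w''`-components. [folklore] -/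
private theorem fst_coe_prod_apply {ι : Type*} [Fintype ι] (U : ι → ideleGroup K) (w'' : InfinitePlace K) :
    (((∏ i, U i : ideleGroup K) : AdeleRing (𝓞 K) K)).1 w'' = ∏ i, ((U i : ideleGroup K) : AdeleRing (𝓞 K) K).1 w'' := by
  change QuadraticForms.adeleInfiniteComponent K w'' _ = _
  rw [Units.coe_prod, map_prod]
  rfl

/-- the finite part of a product of idèles with trivial finite parts is trivial. [folklore] -/
private theorem snd_coe_prod_eq_one {ι : Type*} [Fintype ι] (U : ι → ideleGroup K)
    (hU : ∀ i, ((U i : ideleGroup K) : AdeleRing (𝓞 K) K).2 = 1) :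
    (((∏ i, U i : ideleGroup K) : AdeleRing (𝓞 K) K)).2 = 1 := by
  rw [Units.coe_prod]
  refine Finset.prod_induction _ (fun a : AdeleRing (𝓞 K) K => a.2 = 1) (fun a b ha hb => ?_) rfl fun i _ => hU i
  change a.2 * b.2 = 1
  rw [ha, hb, one_mul]

/-- **`u = ∏_{w ∣ ∞} ⟨u_w⟩_w` for an idèle `u` with trivial finite part** (an archimedean idèle is the product of the
idèles supported at one infinite place). [cite: CasselsFrohlichANT1967, Ch. II §14] -/
theorem eq_prod_infiniteIdeleSingle_of_snd_eq_one (u : ideleGroup K) (hu : ((u : ideleGroup K) : AdeleRing (𝓞 K) K).2 = 1) :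
    u = ∏ w : InfinitePlace K, infiniteIdeleSingle w (QuadraticForms.ideleInfiniteComponent K w u) := by
  apply Units.ext
  refine Prod.ext (funext fun w'' => ?_) ?_
  · rw [fst_coe_prod_apply, Finset.prod_eq_single w'']
    · rw [infiniteIdeleSingle_fst_self]
      rfl
    · intro w _ hne
      exact infiniteIdeleSingle_fst_of_ne _ hne.symm
    · exact fun hh => absurd (Finset.mem_univ _) hh
  · rw [hu]
    exact (snd_coe_prod_eq_one K _ fun w => infiniteIdeleSingle_snd w _).symm

/-- **THE PRODUCT FORMULA AT `∞`: `χ(u) = ∏_{w ∣ ∞} χ_w(u_w)`** for an idèle `u` with trivial finite part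
(`χ_w = χ.archComponent w`, `u_w = ideleInfiniteComponent K w u`). [cite: TateThesis1967, §4.3] -/
theorem apply_eq_prod_archComponent_of_snd_eq_one (χ : HeckeCharacter K) (u : ideleGroup K)
    (hu : ((u : ideleGroup K) : AdeleRing (𝓞 K) K).2 = 1) :
    χ u = ∏ w : InfinitePlace K, χ.archComponent w (QuadraticForms.ideleInfiniteComponent K w u) := by
  conv_lhs => rw [eq_prod_infiniteIdeleSingle_of_snd_eq_one K u hu, map_prod]
  rfl

variable (F : Type) [Field F] (E : Type) [Field E] [NumberField E] [Algebra F E]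

omit [NumberField K] in
/-- **regrouping `∏_{w ∣ ∞ of E} = ∏_{v ∣ ∞ of F} ∏_{w ∣ v}`** along `w ↦ w|_F` (Mathlib `Equiv.sigmaFiberEquiv`).
[cite: CasselsFrohlichANT1967, Ch. II §14] -/
theorem prod_infinitePlace_eq_prod_placesOver [NumberField F] {M : Type*} [CommMonoid M] (f : InfinitePlace E → M) :
    ∏ w : InfinitePlace E, f w = ∏ v : InfinitePlace F, ∏ w : InfPlacesOver E v, f w.1 := by
  rw [← (Equiv.sigmaFiberEquiv fun w : InfinitePlace E => w.comap (algebraMap F E)).prod_comp f, Fintype.prod_sigma]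
  rfl

end AnyField

/-! ## §2 Base change of the idèle supported at one infinite place -/

section BaseChange

variable (F : Type) [Field F] [NumberField F] (E : Type) [Field E] [NumberField E] [Algebra F E]

/-- **`(⟨x⟩_v)_E = ∏_{w ∣ v} ⟨ι_w x⟩_w`**: the base change to `𝕀_E` of the idèle of `F` supported at the infinite place `v`
is the product over the places `w ∣ v` of the idèles supported at `w` with component the local base change `ι_w x`.
[cite: CasselsFrohlichANT1967, Ch. II §14] -/
theorem ideleBaseChange_infiniteIdeleSingle (v : InfinitePlace F) (x : (v.Completion)ˣ) :
    AdeleRing.ideleBaseChange F E (infiniteIdeleSingle v x) =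
      ∏ w : InfPlacesOver E v, infiniteIdeleSingle w.1 (Units.map (toInfPlace E v w).toMonoidHom x) := by
  apply Units.ext
  refine Prod.ext (funext fun w'' => ?_) ?_
  · rw [fst_coe_prod_apply, AdeleRing.coe_ideleBaseChange, AdeleRing.baseChange_fst]
    by_cases h : w''.comap (algebraMap F E) = v
    · -- `w'' ∣ v`: the component is `ι_{w''} x`, the single factor `w = ⟨w'', h⟩` of the product
      rw [infiniteAdele_baseChange_apply_placesOver E v _ ⟨w'', h⟩, infiniteIdeleSingle_fst_self,
        Finset.prod_eq_single (⟨w'', h⟩ : InfPlacesOver E v)]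
      · rw [infiniteIdeleSingle_fst_self]
        rfl
      · intro w _ hne
        exact infiniteIdeleSingle_fst_of_ne _ fun heq : w'' = w.1 => hne (Subtype.ext heq.symm)
      · exact fun hh => absurd (Finset.mem_univ _) hh
    · rw [InfiniteAdeleRing.baseChange_apply, infiniteIdeleSingle_fst_of_ne x h, map_one]
      refine (Finset.prod_eq_one fun (w : InfPlacesOver E v) _ => infiniteIdeleSingle_fst_of_ne _ ?_).symm
      intro heq
      rw [heq] at h
      exact h w.2
  · rw [AdeleRing.coe_ideleBaseChange, AdeleRing.baseChange_snd, infiniteIdeleSingle_snd, map_one]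
    exact (snd_coe_prod_eq_one E _ fun w : InfPlacesOver E v => infiniteIdeleSingle_snd w.1 _).symm

/-- **`χ((⟨x⟩_v)_E) = ∏_{w ∣ v} χ_w(ι_w x)`** for a Hecke character `χ` of `E`, an infinite place `v` of `F`, `x ∈ F_vˣ`.
[cite: TateThesis1967, §4.3] -/
theorem apply_ideleBaseChange_infiniteIdeleSingle (χ : HeckeCharacter E) (v : InfinitePlace F) (x : (v.Completion)ˣ) :
    χ (AdeleRing.ideleBaseChange F E (infiniteIdeleSingle v x)) =
      ∏ w : InfPlacesOver E v, χ.archComponent w.1 (Units.map (toInfPlace E v w).toMonoidHom x) := by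
  rw [ideleBaseChange_infiniteIdeleSingle, map_prod]
  rfl

end BaseChange

/-! ## §3 Splitting characters of a quadratic `E/F`: `∏_{w ∣ v} χ_w(ι_w x) = ε_v(x)^m`; trivial over split places -/

section Splitting

variable {F : Type} [Field F] [NumberField F] {E : Type} [Field E] [NumberField E] [Algebra F E]
  [Algebra.IsQuadraticExtension F E]

/-- **`∏_{w ∣ v} χ_w(ι_w x) = ε_{E/F,v}(x)^m`** for `χ|_{𝕀_F} = ε_{E/F}^m` (`IsSplittingCharExt F E m χ`), every infinite place `v`
of `F` and `x ∈ F_vˣ`. [cite: HarrisKudlaSweet1996, §1 (1.5) p. 951] -/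
theorem _root_.Literature.RepresentationTheory.HarrisKudlaSweet1996.IsSplittingCharExt.prod_archComponent_placesOver
    {m : ℕ} {χ : HeckeCharacter E} (hχ : IsSplittingCharExt F E m χ) (v : InfinitePlace F) (x : (v.Completion)ˣ) :
    ∏ w : InfPlacesOver E v, χ.archComponent w.1 (Units.map (toInfPlace E v w).toMonoidHom x) =
      (quadraticHeckeCharExt F E).archComponent v x ^ m := by
  rw [← apply_ideleBaseChange_infiniteIdeleSingle, hχ, HeckeCharacter.archComponent_apply]

/-- **at a COMPLEX place `v` of `F`: `∏_{w ∣ v} χ_w(ι_w x) = 1`** (`v` splits in `E`, `ε_{E/F,v} = 1`: the two archimedean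
components over `v` are mutually inverse along the local base changes — the archimedean twin of
`QuadExt.localComponent_galInv_inv_eq`). [cite: HarrisKudlaSweet1996, §1 (1.5) p. 951] [cite: GelbartRogawski1991, §3.1 p. 456 (3.1.2)] -/
theorem _root_.Literature.RepresentationTheory.HarrisKudlaSweet1996.IsSplittingCharExt.prod_archComponent_placesOver_of_isComplex
    {m : ℕ} {χ : HeckeCharacter E} (hχ : IsSplittingCharExt F E m χ) {v : InfinitePlace F} (hv : v.IsComplex)
    (x : (v.Completion)ˣ) :
    ∏ w : InfPlacesOver E v, χ.archComponent w.1 (Units.map (toInfPlace E v w).toMonoidHom x) = 1 := by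
  rw [hχ.prod_archComponent_placesOver, HeckeCharacter.archComponent_apply, quadraticHeckeCharExt_def,
    quadraticHeckeChar_infiniteIdeleSingle_of_isComplex (not_isSquare_quadExtGenerator F E) hv, one_pow]

/-- **at a REAL place `v` of `F` SPLIT in `E`** (`σ_v(θ) > 0` for the generator `E = F(√θ)`, `θ = quadExtGenerator F E`):
`∏_{w ∣ v} χ_w(ι_w x) = 1`. [cite: HarrisKudlaSweet1996, §1 (1.5) p. 951] -/
theorem _root_.Literature.RepresentationTheory.HarrisKudlaSweet1996.IsSplittingCharExt.prod_archComponent_placesOver_of_pos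
    {m : ℕ} {χ : HeckeCharacter E} (hχ : IsSplittingCharExt F E m χ) {v : InfinitePlace F} (hv : v.IsReal)
    (hpos : 0 < embedding_of_isReal hv ((quadExtGenerator F E : 𝓞 F) : F)) (x : (v.Completion)ˣ) :
    ∏ w : InfPlacesOver E v, χ.archComponent w.1 (Units.map (toInfPlace E v w).toMonoidHom x) = 1 := by
  rw [hχ.prod_archComponent_placesOver, HeckeCharacter.archComponent_apply, quadraticHeckeCharExt_def,
    quadraticHeckeChar_infiniteIdeleSingle_of_pos (not_isSquare_quadExtGenerator F E) hv hpos, one_pow]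

/-- **at a REAL place `v` of `F` INERT in `E`** (`σ_v(θ) < 0`): `∏_{w ∣ v} χ_w(ι_w x) = sgn(x)^m` — here there is ONE
(complex) place `w` over `v` and `χ_w|_{ℝˣ} = sgn^m`. [cite: HarrisKudlaSweet1996, §1 (1.5) p. 951] -/
theorem _root_.Literature.RepresentationTheory.HarrisKudlaSweet1996.IsSplittingCharExt.prod_archComponent_placesOver_of_neg
    {m : ℕ} {χ : HeckeCharacter E} (hχ : IsSplittingCharExt F E m χ) {v : InfinitePlace F} (hv : v.IsReal)
    (hneg : embedding_of_isReal hv ((quadExtGenerator F E : 𝓞 F) : F) < 0) (x : (v.Completion)ˣ) :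
    ((∏ w : InfPlacesOver E v, χ.archComponent w.1 (Units.map (toInfPlace E v w).toMonoidHom x) : ℂˣ) : ℂ) =
      (if 0 < Completion.ringEquivRealOfIsReal hv (x : v.Completion) then 1 else -1) ^ m := by
  rw [hχ.prod_archComponent_placesOver, HeckeCharacter.archComponent_apply, quadraticHeckeCharExt_def, Units.val_pow_eq_pow_val,
    quadraticHeckeChar_infiniteIdeleSingle_of_neg (not_isSquare_quadExtGenerator F E) hv hneg]

/-- **for `m = 1` at a complex place, in pairs**: if `w₁ ≠ w₂` both lie over the complex place `v` then
`χ_{w₁}(ι_{w₁} x) · χ_{w₂}(ι_{w₂} x) = 1` — given that `w₁, w₂` exhaust the places over `v` (for a quadratic `E/F` there are at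
most two). [cite: GelbartRogawski1991, §3.1 p. 456 (3.1.2)] -/
theorem _root_.Literature.RepresentationTheory.HarrisKudlaSweet1996.IsSplittingCharExt.archComponent_mul_archComponent_of_isComplex
    {m : ℕ} {χ : HeckeCharacter E} (hχ : IsSplittingCharExt F E m χ) {v : InfinitePlace F} (hv : v.IsComplex)
    (w₁ w₂ : InfPlacesOver E v) (hne : w₁ ≠ w₂) (hall : ∀ w : InfPlacesOver E v, w = w₁ ∨ w = w₂) (x : (v.Completion)ˣ) :
    χ.archComponent w₁.1 (Units.map (toInfPlace E v w₁).toMonoidHom x) *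
      χ.archComponent w₂.1 (Units.map (toInfPlace E v w₂).toMonoidHom x) = 1 := by
  have huniv : (Finset.univ : Finset (InfPlacesOver E v)) = {w₁, w₂} := by
    ext w
    simp only [Finset.mem_univ, Finset.mem_insert, Finset.mem_singleton, true_iff]
    exact hall w
  have h := hχ.prod_archComponent_placesOver_of_isComplex hv x
  rwa [huniv, Finset.prod_pair hne] at h

end Splitting

end Literature.NumberTheory.GelbartRogawski1991.UnitaryDualPair.ArchSplitting.QuadExt

end
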